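import Literature.MathematicalPhysics.QuantumLattice.SlaterWindowReducedDensityMatrix
import Literature.MathematicalPhysics.QuantumLattice.FermionRankOneParity
import HarnessLib

/-!
# Slater determinants dressed by commuting local unitaries: the variational bound and the light cone

Topic `MathematicalPhysics/QuantumLattice`, family `hubbard`; continuation of
`HartreeFockUpperBound.lean` (`E₀(N) ≤ re ω_P(H)`, the Slater state `ω_P` of an orthogonal
projection `P` with `tr P = N`) and `SlaterWindowReducedDensityMatrix.lean` (`ω_P ∘ Γ(φ)` on a
window is the explicit polynomial `slaterRDM`). For trial states `Ψ = 𝒰 Φ_P` obtained from a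
Slater determinant by a particle-number conserving unitary `𝒰` — in applications a product of
commuting EVEN unitaries `Γ(φ_c) u_c` living on pairwise disjoint windows `φ_c : Λ₀ ↪ Λ`
("local unitary cluster" / dressed Hartree–Fock states) — we prove:

* `groundEnergy_le_groundEnergy_conj` — `E_N(H) ≤ E_N(Vᴴ H V)` for `Vᴴ V = 1` mapping `N`-particle
  vectors to `N`-particle vectors (the variational set of `Vᴴ H V` is moved into that of `H` by `V`);
  hence `HartreeFock.groundEnergy_le_re_groundStateFunctional_conj` —
  **`E₀(N) ≤ re ω_P(Vᴴ H V)`** for every such `V` (BLS94 (2c.36) for the dressed state);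
* `isNParticle_iff_totalNumberOp_mulVec`, `IsNParticle.mulVec_of_commute` — operators commuting with
  `N̂` preserve the `N`-particle sector; `mem_carEvenSubalgebra_univ_of_commute_totalNumberOp` —
  an operator commuting with `N̂` is EVEN; `commute_totalNumberOp_fermionEmbed`,
  `fermionEmbed_mem_carEvenSubalgebra_of_commute` — both properties pass to the embedded operator
  `Γ(φ) u` (the particles outside the window commute with it, `totalNumberOp_commutator_fermionEmbed`);
* `commute_fermionEmbed_of_disjoint` — **light cone**: an even operator embedded in a window
  commutes with every operator embedded in a disjoint window (graded locality,
  `commute_fermionEmbed_of_mem_carEvenSubalgebra`); `conjTranspose_mul_fermionEmbed_mul_of_commute` —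
  consequently, if `𝒰 = W · Γ(ψ) v` with `Wᴴ W = 1` and `W` commuting with the window `ψ`, then
  `𝒰ᴴ Γ(ψ)B 𝒰 = Γ(ψ)(vᴴ B v)`: conjugating a window observable by the dressing only involves the
  dressing factors inside the window;
* `conjTranspose_noncommProd_mul_self`, `commute_totalNumberOp_noncommProd` — products of commuting
  factors with `Fᴴ F = 1` (resp. commuting with `N̂`) have the same property.

Sources: V. Bach, E. H. Lieb, J. P. Solovej, J. Stat. Phys. 76 (1994) 3, eq. (2c.36) (variational
principle for quasi-free states) [BachLiebSolovej1994]; O. Bratteli, D. W. Robinson II (1997) §5.2.2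
(even elements of disjoint local CAR algebras commute) [BratteliRobinsonII1997]. The dressing by
local unitaries is the standard "local unitary transformation" of quantum-information treatments
of lattice states (X. Chen, Z.-C. Gu, X.-G. Wen, Phys. Rev. B 82 (2010) 155138, §II) — here only
its elementary algebra is used. Everything is proved; no definitions, no named facts.

## Mathlib / tree search

Tree (REUSED): `groundEnergy`, `bddBelow_energySet`, `expect` (`HubbardWave0*`),
`HartreeFock.groundEnergy_le_re_groundStateFunctional`, `totalNumberOp_eq_diagonal`,
`totalNumberOp_commutator_fermionEmbed`, `fermionEmbed_mem_carEvenSubalgebra`,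
`commute_fermionEmbed_of_mem_carEvenSubalgebra`, `single_mem_carEvenSubalgebra_of_even`,
`disjoint_orbs`, `fermionEmbed_*` algebra lemmas. Mathlib: `Finset.noncommProd`,
`Finset.noncommProd_insert_of_notMem`, `Finset.noncommProd_commute`, `csInf_le_csInf`,
`Matrix.matrix_eq_sum_single`. `lean search 'dressed|localUnitary|conj.*groundEnergy'`: only
`Matrix.groundEnergy_unitary_conj` (full-space ground energy, `XYOrderDischarges`) and the sector
version for relabellings `groundEnergy_relabel` — no sector statement for general unitaries.
-/

noncomputable section

namespace Literature.MathematicalPhysics.QuantumLattice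

open Matrix Finset HubbardWave0
open scoped ComplexOrder Function

/-! ### §1. The variational principle for unitarily dressed states -/

section Variational

variable {ι : Type*} [LinearOrder ι] [Fintype ι]

/-- `ψ` is an `N`-particle vector iff `N̂ ψ = N ψ`. [folklore] -/
theorem isNParticle_iff_totalNumberOp_mulVec (N : ℕ) (ψ : Fock ι) :
    IsNParticle N ψ ↔ (totalNumberOp : Matrix (Finset ι) (Finset ι) ℂ) *ᵥ ψ = (N : ℂ) • ψ := by
  rw [totalNumberOp_eq_diagonal]
  constructor
  · intro h
    funext s
    rw [mulVec_diagonal, Pi.smul_apply, smul_eq_mul]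
    by_cases hs : s.card = N
    · rw [hs]
    · rw [h s hs, mul_zero, mul_zero]
  · intro h s hs
    have h' := congrFun h s
    rw [mulVec_diagonal, Pi.smul_apply, smul_eq_mul, ← sub_eq_zero, ← sub_mul, mul_eq_zero] at h'
    rcases h' with h' | h'
    · exact absurd (by exact_mod_cast (sub_eq_zero.1 h')) hs
    · exact h'

/-- An operator commuting with `N̂` preserves the `N`-particle sector. [folklore] -/
theorem IsNParticle.mulVec_of_commute {N : ℕ} {ψ : Fock ι} (hψ : IsNParticle N ψ)
    {B : Matrix (Finset ι) (Finset ι) ℂ} (hB : Commute totalNumberOp B) : IsNParticle N (B *ᵥ ψ) := by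
  rw [isNParticle_iff_totalNumberOp_mulVec] at hψ ⊢
  rw [mulVec_mulVec, hB.eq, ← mulVec_mulVec, hψ, mulVec_smul]

/-- **`E_N(H) ≤ E_N(Vᴴ H V)`** for `Vᴴ V = 1` mapping `N`-particle vectors to `N`-particle vectors:
`V` moves every unit `N`-particle trial vector of `Vᴴ H V` to one of `H` with the same energy.
[cite: BachLiebSolovej1994, eq. (2c.36)] -/
theorem groundEnergy_le_groundEnergy_conj (H V : Matrix (Finset ι) (Finset ι) ℂ) (hV : Vᴴ * V = 1)
    {N : ℕ} (hVN : ∀ ψ : Fock ι, IsNParticle N ψ → IsNParticle N (V *ᵥ ψ)) :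
    groundEnergy H N ≤ groundEnergy (Vᴴ * H * V) N := by
  set S := {E : ℝ | ∃ ψ : Fock ι, IsNParticle N ψ ∧ star ψ ⬝ᵥ ψ = 1 ∧ E = (expect H ψ).re} with hS
  set S' := {E : ℝ | ∃ ψ : Fock ι, IsNParticle N ψ ∧ star ψ ⬝ᵥ ψ = 1 ∧
    E = (expect (Vᴴ * H * V) ψ).re} with hS'
  have hnorm : ∀ ψ : Fock ι, star (V *ᵥ ψ) ⬝ᵥ (V *ᵥ ψ) = star ψ ⬝ᵥ ψ := by
    intro ψ
    rw [star_mulVec, ← dotProduct_mulVec, mulVec_mulVec, hV, one_mulVec]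
  have hexp : ∀ ψ : Fock ι, expect (Vᴴ * H * V) ψ = expect H (V *ᵥ ψ) := by
    intro ψ
    rw [expect, expect, star_mulVec, ← dotProduct_mulVec, mulVec_mulVec, mulVec_mulVec]
  have hsub : S' ⊆ S := by
    rintro E ⟨ψ, hN, h1, rfl⟩
    exact ⟨V *ᵥ ψ, hVN ψ hN, by rw [hnorm, h1], by rw [hexp]⟩
  change sInf S ≤ sInf S'
  rcases S'.eq_empty_or_nonempty with h | h
  · have hS0 : S = ∅ := by
      refine Set.eq_empty_iff_forall_notMem.2 fun E hE => ?_
      obtain ⟨ψ, hN, h1, -⟩ := hE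
      exact (Set.eq_empty_iff_forall_notMem.1 h) _ ⟨ψ, hN, h1, rfl⟩
    rw [h, hS0]
  · exact csInf_le_csInf (LiebThm1.bddBelow_energySet H N) h hsub

/-- **Variational principle for a unitarily dressed Slater determinant**: for an orthogonal
projection `P` with `tr P = N`, any operator `H`, and any `V` with `Vᴴ V = 1` commuting with the
particle number, `E₀(N) ≤ re ω_P(Vᴴ H V)` — the energy of the trial state `V Φ_P`.
BLS94 (2c.36) combined with `groundEnergy_le_groundEnergy_conj`. [cite: BachLiebSolovej1994, eq. (2c.36)] -/
theorem HartreeFock.groundEnergy_le_re_groundStateFunctional_conj {P : Matrix ι ι ℂ}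
    (hP : P.IsHermitian) (hPP : P * P = P) {N : ℕ} (htr : P.trace = N)
    (H V : Matrix (Finset ι) (Finset ι) ℂ) (hV : Vᴴ * V = 1) (hVN : Commute totalNumberOp V) :
    groundEnergy H N ≤ ((dGamma (HartreeFock.hfOneBody P)).groundStateFunctional (Vᴴ * H * V)).re :=
  (groundEnergy_le_groundEnergy_conj H V hV fun _ hψ => hψ.mulVec_of_commute hVN).trans
    (HartreeFock.groundEnergy_le_re_groundStateFunctional hP hPP htr _)

/-- An operator commuting with `N̂` has entries only between configurations of equal particle
number. [folklore] -/
theorem apply_eq_zero_of_commute_totalNumberOp {u : Matrix (Finset ι) (Finset ι) ℂ}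
    (hu : Commute totalNumberOp u) {s t : Finset ι} (hst : s.card ≠ t.card) : u s t = 0 := by
  have h := congrFun (congrFun hu.eq s) t
  rw [totalNumberOp_eq_diagonal, diagonal_mul, mul_diagonal, ← sub_eq_zero, mul_comm (u s t),
    ← sub_mul, mul_eq_zero] at h
  rcases h with h | h
  · exact absurd (by exact_mod_cast (sub_eq_zero.1 h)) hst
  · exact h

/-- **Operators commuting with the particle number are even.** [cite: BratteliRobinsonII1997, §5.2.2] -/
theorem mem_carEvenSubalgebra_univ_of_commute_totalNumberOp {u : Matrix (Finset ι) (Finset ι) ℂ}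
    (hu : Commute totalNumberOp u) : u ∈ carEvenSubalgebra (univ : Finset ι) := by
  rw [Matrix.matrix_eq_sum_single u]
  refine Subalgebra.sum_mem _ fun s _ => Subalgebra.sum_mem _ fun t _ => ?_
  by_cases hst : s.card = t.card
  · rw [show Matrix.single s t (u s t) = u s t • Matrix.single s t (1 : ℂ) by
        rw [Matrix.smul_single, smul_eq_mul, mul_one]]
    exact Subalgebra.smul_mem _ (single_mem_carEvenSubalgebra_of_even ⟨s.card, by rw [hst]⟩) _
  · rw [apply_eq_zero_of_commute_totalNumberOp hu hst, Matrix.single_zero]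
    exact Subalgebra.zero_mem _

end Variational

/-! ### §2. Embedded window unitaries: particle number, evenness, light cone -/

section Embedded

variable {Λ₀ Λ₁ Λ : Type*} [LinearOrder Λ₀] [Fintype Λ₀] [LinearOrder Λ₁] [Fintype Λ₁]
  [LinearOrder Λ] [Fintype Λ]

/-- `Γ(φ) u` commutes with the particle number of `Λ` when `u` commutes with that of the window.
[cite: BratteliRobinsonII1997, §5.2.2] -/
theorem commute_totalNumberOp_fermionEmbed (φ : Λ₀ ↪ Λ) {u : Matrix (Finset (Orb Λ₀)) (Finset (Orb Λ₀)) ℂ}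
    (hu : Commute totalNumberOp u) : Commute totalNumberOp (fermionEmbed φ u) := by
  have h := totalNumberOp_commutator_fermionEmbed φ u
  rw [show totalNumberOp * u - u * totalNumberOp = 0 from sub_eq_zero.2 hu.eq, fermionEmbed_zero,
    sub_eq_zero] at h
  exact h

/-- `Γ(φ) u` is even when `u` commutes with the particle number of the window.
[cite: BratteliRobinsonII1997, §5.2.2] -/
theorem fermionEmbed_mem_carEvenSubalgebra_of_commute (φ : Λ₀ ↪ Λ)
    {u : Matrix (Finset (Orb Λ₀)) (Finset (Orb Λ₀)) ℂ} (hu : Commute totalNumberOp u) :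
    fermionEmbed φ u ∈ carEvenSubalgebra (orbs ((univ : Finset Λ₀).map φ)) :=
  fermionEmbed_mem_carEvenSubalgebra φ (mem_carEvenSubalgebra_univ_of_commute_totalNumberOp hu)

/-- `Γ(φ)(uᴴ u) = 1` from `uᴴ u = 1`. [folklore] -/
theorem conjTranspose_fermionEmbed_mul_self (φ : Λ₀ ↪ Λ) {u : Matrix (Finset (Orb Λ₀)) (Finset (Orb Λ₀)) ℂ}
    (hu : uᴴ * u = 1) : (fermionEmbed φ u)ᴴ * fermionEmbed φ u = 1 := by
  rw [← fermionEmbed_conjTranspose, ← fermionEmbed_mul, hu, fermionEmbed_one]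

/-- **Light cone**: an even operator embedded in the window `φ₀` commutes with every operator
embedded in a window `φ₁` with disjoint image. [cite: BratteliRobinsonII1997, §5.2.2] -/
theorem commute_fermionEmbed_of_disjoint (φ₀ : Λ₀ ↪ Λ) (φ₁ : Λ₁ ↪ Λ)
    (hdisj : Disjoint ((univ : Finset Λ₀).map φ₀) ((univ : Finset Λ₁).map φ₁))
    {u : Matrix (Finset (Orb Λ₀)) (Finset (Orb Λ₀)) ℂ} (hu : u ∈ carEvenSubalgebra (univ : Finset (Orb Λ₀)))
    (B : Matrix (Finset (Orb Λ₁)) (Finset (Orb Λ₁)) ℂ) :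
    Commute (fermionEmbed φ₀ u) (fermionEmbed φ₁ B) :=
  commute_fermionEmbed_of_mem_carEvenSubalgebra φ₁ B (fermionEmbed_mem_carEvenSubalgebra φ₀ hu)
    (disjoint_orbs hdisj)

/-- **Conjugating a window observable by a dressing `W · Γ(ψ) v` whose outer part `W` commutes with
the window**: `(W Γ(ψ)v)ᴴ Γ(ψ)B (W Γ(ψ)v) = Γ(ψ)(vᴴ B v)` for `Wᴴ W = 1`. [cite: BratteliRobinsonII1997, §5.2.2] -/
theorem conjTranspose_mul_fermionEmbed_mul_of_commute (ψ : Λ₁ ↪ Λ)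
    {W : Matrix (Finset (Orb Λ)) (Finset (Orb Λ)) ℂ} (hW : Wᴴ * W = 1)
    (v B : Matrix (Finset (Orb Λ₁)) (Finset (Orb Λ₁)) ℂ) (hc : Commute W (fermionEmbed ψ B)) :
    (W * fermionEmbed ψ v)ᴴ * fermionEmbed ψ B * (W * fermionEmbed ψ v) = fermionEmbed ψ (vᴴ * B * v) := by
  rw [conjTranspose_mul, fermionEmbed_mul, fermionEmbed_mul, fermionEmbed_conjTranspose]
  calc (fermionEmbed ψ v)ᴴ * Wᴴ * fermionEmbed ψ B * (W * fermionEmbed ψ v)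
      = (fermionEmbed ψ v)ᴴ * (Wᴴ * (fermionEmbed ψ B * W)) * fermionEmbed ψ v := by
        simp only [Matrix.mul_assoc]
    _ = (fermionEmbed ψ v)ᴴ * (Wᴴ * (W * fermionEmbed ψ B)) * fermionEmbed ψ v := by rw [hc.eq]
    _ = (fermionEmbed ψ v)ᴴ * fermionEmbed ψ B * fermionEmbed ψ v := by
        rw [← Matrix.mul_assoc Wᴴ, hW, Matrix.one_mul]

end Embedded

/-! ### §3. Products of commuting dressing factors -/

section Products

variable {n : Type*} [Fintype n] [DecidableEq n] {C : Type*}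

/-- `(∏ F_c)ᴴ (∏ F_c) = 1` for pairwise commuting factors with `F_cᴴ F_c = 1` (telescoping; the
commutativity is only needed to form the product). [folklore] -/
theorem conjTranspose_noncommProd_mul_self [DecidableEq C] (s : Finset C) (F : C → Matrix n n ℂ)
    (comm : Set.Pairwise (↑s : Set C) (Commute on F)) (hF : ∀ c ∈ s, (F c)ᴴ * F c = 1) :
    (s.noncommProd F comm)ᴴ * s.noncommProd F comm = 1 := by
  induction s using Finset.induction_on with
  | empty => simp
  | insert a s ha ih =>
    rw [Finset.noncommProd_insert_of_notMem _ _ _ _ ha, conjTranspose_mul, Matrix.mul_assoc,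
      ← Matrix.mul_assoc (F a)ᴴ, hF a (mem_insert_self a s), Matrix.one_mul]
    exact ih (comm.mono fun _ => mem_insert_of_mem) fun c hc => hF c (mem_insert_of_mem hc)

/-- A product of factors commuting with `y` commutes with `y`. [folklore] -/
theorem commute_noncommProd_of_forall (s : Finset C) (F : C → Matrix n n ℂ)
    (comm : Set.Pairwise (↑s : Set C) (Commute on F)) {y : Matrix n n ℂ} (h : ∀ c ∈ s, Commute y (F c)) :
    Commute y (s.noncommProd F comm) :=
  Finset.noncommProd_commute s F comm y h

end Products

end Literature.MathematicalPhysics.QuantumLattice
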